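import Mathlib.GroupTheory.SpecificGroups.Dihedral
import Mathlib.Algebra.Group.Subgroup.Basic
import Mathlib.Data.ZMod.Basic

/-!
# The dihedral subgroups `K_d = ⟨r^d, s⟩ ⊆ D_m` — self-normalising for odd `m`, pairwise non-conjugate
# (group-theoretic substrate of a non-vacuity witness for [IUTchII] Def 2.3 (ii)(iii), the label classes of cusps)

S. Mochizuki, *Inter-universal Teichmüller theory II*, kurims manuscript (Dec. 2020), §2 Def 2.3 (ii)(iii) p. 68
(`LabCusp^±(Π_v)`: cuspidal inertia groups up to conjugacy of their normalisers in `Π^±_v`, a set of cardinality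
`l`) [claim: Mochizuki2012, status: disputed] (D-0012 claim key; nothing printed is asserted).

PURE FINITE GROUP THEORY (no claim about print): for the dihedral group `D_m = ⟨r, s⟩` of order `2m` and
`d ∈ ℤ/m`, the subgroup `dsub m d := {r^{dk}, s r^{dk}}` (`= ⟨r^d, s⟩`, a dihedral subgroup);
* `normalizer_dsub_eq` — for `m` ODD every `dsub m d` is SELF-NORMALISING in `D_m`;
* `r_mem_map_conj_dsub_iff` — rotation membership `r^j ∈ K` is invariant under conjugating `K = dsub m d`;
* `le_of_pow_three_mem_dsub` — in `D_{3^l}`, `r^{3^s} ∈ dsub (3^t)` forces `t ≤ s` (for `s, t < l`).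
Consumer: `DihedralCuspToy.lean` (abc-iut-w5-d243, NV-L6 wave: a CLOSED tower with exactly `l` label
classes of cusps, inhabiting abc-iut-L6-t1's `LabCuspStructure`). [claim: Mochizuki2012, status: disputed]
(IUTchII §2 Def 2.3 (iii), kurims p.68)
-/

namespace Literature.IUT.HodgeArakelov

namespace DihedralCuspToy

open DihedralGroup

variable (m : ℕ)

/-- The dihedral subgroup `K_d = {r^{dk}, s r^{dk} | k} = ⟨r^d, s⟩` of `D_m`.
[claim: Mochizuki2012, status: disputed] (IUTchII §2 Def 2.3 (iii), kurims p.68) -/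
def dsub (d : ZMod m) : Subgroup (DihedralGroup m) where
  carrier := {g | ∃ k : ZMod m, g = r (d * k) ∨ g = sr (d * k)}
  mul_mem' := by
    rintro a b ⟨k, ha | ha⟩ ⟨k', hb | hb⟩ <;> subst ha <;> subst hb
    · exact ⟨k + k', Or.inl (by rw [r_mul_r, mul_add])⟩
    · exact ⟨k' - k, Or.inr (by rw [r_mul_sr, mul_sub])⟩
    · exact ⟨k + k', Or.inr (by rw [sr_mul_r, mul_add])⟩
    · exact ⟨k' - k, Or.inl (by rw [sr_mul_sr, mul_sub])⟩
  one_mem' := ⟨0, Or.inl (by rw [mul_zero, r_zero])⟩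
  inv_mem' := by
    rintro a ⟨k, ha | ha⟩ <;> subst ha
    · exact ⟨-k, Or.inl (by rw [inv_r, mul_neg])⟩
    · exact ⟨k, Or.inr (by rw [inv_sr])⟩

/-- Rotations in `K_d`: `r^j ∈ K_d ↔ d ∣ j`. [claim: Mochizuki2012, status: disputed] (IUTchII §2 Def 2.3 (iii), kurims p.68) -/
theorem r_mem_dsub_iff (d j : ZMod m) : r j ∈ dsub m d ↔ ∃ k : ZMod m, j = d * k := by
  constructor
  · rintro ⟨k, h | h⟩
    · exact ⟨k, by injection h⟩
    · cases h
  · rintro ⟨k, rfl⟩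
    exact ⟨k, Or.inl rfl⟩

/-- Reflections in `K_d`: `s r^j ∈ K_d ↔ d ∣ j`. [claim: Mochizuki2012, status: disputed] (IUTchII §2 Def 2.3 (iii), kurims p.68) -/
theorem sr_mem_dsub_iff (d j : ZMod m) : sr j ∈ dsub m d ↔ ∃ k : ZMod m, j = d * k := by
  constructor
  · rintro ⟨k, h | h⟩
    · cases h
    · exact ⟨k, by injection h⟩
  · rintro ⟨k, rfl⟩
    exact ⟨k, Or.inr rfl⟩

/-- `s ∈ K_d`. [claim: Mochizuki2012, status: disputed] (IUTchII §2 Def 2.3 (iii), kurims p.68) -/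
theorem sr_zero_mem_dsub (d : ZMod m) : sr 0 ∈ dsub m d :=
  (sr_mem_dsub_iff m d 0).mpr ⟨0, (mul_zero d).symm⟩

/-- `r^d ∈ K_d`. [claim: Mochizuki2012, status: disputed] (IUTchII §2 Def 2.3 (iii), kurims p.68) -/
theorem r_self_mem_dsub (d : ZMod m) : r d ∈ dsub m d :=
  (r_mem_dsub_iff m d d).mpr ⟨1, (mul_one d).symm⟩

/-- Conjugating a rotation in `D_m` gives `r^{±j}`. [claim: Mochizuki2012, status: disputed] (IUTchII §2 Def 2.3 (iii), kurims p.68) -/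
theorem conj_r (g : DihedralGroup m) (j : ZMod m) : g * r j * g⁻¹ = r j ∨ g * r j * g⁻¹ = r (-j) := by
  rcases g with i | i
  · left
    rw [inv_r, r_mul_r, r_mul_r]
    exact congrArg r (by ring)
  · right
    rw [inv_sr, sr_mul_r, sr_mul_sr]
    exact congrArg r (by ring)

/-- **Rotation membership is conjugation-invariant for the dihedral subgroups**: `r^j ∈ g K_d g⁻¹ ↔ r^j ∈ K_d`.
[claim: Mochizuki2012, status: disputed] (IUTchII §2 Def 2.3 (iii), kurims p.68) -/
theorem r_mem_map_conj_dsub_iff (d j : ZMod m) (g : DihedralGroup m) :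
    r j ∈ (dsub m d).map (MulAut.conj g).toMonoidHom ↔ r j ∈ dsub m d := by
  rw [Subgroup.mem_map_equiv, MulAut.conj_symm_apply, r_mem_dsub_iff]
  have key : ∀ j' : ZMod m, (g⁻¹ * r j' * g ∈ dsub m d) ↔ ∃ k : ZMod m, j' = d * k := by
    intro j'
    rcases conj_r m g⁻¹ j' with h | h <;> rw [inv_inv] at h <;> rw [h, r_mem_dsub_iff]
    constructor
    · rintro ⟨k, hk⟩
      exact ⟨-k, by rw [mul_neg, ← hk, neg_neg]⟩
    · rintro ⟨k, rfl⟩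
      exact ⟨-k, by rw [mul_neg]⟩
  exact key j

/-- **For `m` odd, `K_d` is self-normalising in `D_m`** (`2` is a unit mod `m`: `g = r^j` normalises iff
`g s g⁻¹ = s r^{-2j} ∈ K_d` iff `d ∣ 2j` iff `d ∣ j`; `g = s r^i` likewise).
[claim: Mochizuki2012, status: disputed] (IUTchII §2 Def 2.3 (iii), kurims p.68) -/
theorem normalizer_dsub_eq (hm : Odd m) (d : ZMod m) :
    Subgroup.normalizer (dsub m d : Set (DihedralGroup m)) = dsub m d := by
  refine le_antisymm ?_ Subgroup.le_normalizer
  intro g hg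
  rw [Subgroup.mem_normalizer_iff] at hg
  have h2 : IsUnit (2 : ZMod m) := by
    have := (ZMod.isUnit_iff_coprime 2 m).mpr (Nat.coprime_two_left.mpr hm)
    exact_mod_cast this
  obtain ⟨u, hu⟩ := h2
  have hs := (hg (sr 0)).mp (sr_zero_mem_dsub m d)
  rcases g with j | i
  · -- `r^j s r^{-j} = s r^{-2j}`
    rw [inv_r, r_mul_sr, sr_mul_r, sr_mem_dsub_iff] at hs
    obtain ⟨k, hk⟩ := hs
    refine (r_mem_dsub_iff m d j).mpr ⟨-(k * ↑u⁻¹), ?_⟩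
    have : (2 : ZMod m) * j = -(d * k) := by rw [← hk]; ring
    calc j = ((↑u⁻¹ : ZMod m) * ↑u) * j := by rw [Units.inv_mul, one_mul]
      _ = ↑u⁻¹ * (2 * j) := by rw [hu, mul_assoc]
      _ = d * -(k * ↑u⁻¹) := by rw [this]; ring
  · -- `(s r^i) s (s r^i)⁻¹ = s r^{2i}`
    rw [inv_sr, sr_mul_sr, r_mul_sr, sr_mem_dsub_iff] at hs
    obtain ⟨k, hk⟩ := hs
    refine (sr_mem_dsub_iff m d i).mpr ⟨k * ↑u⁻¹, ?_⟩
    have : (2 : ZMod m) * i = d * k := by rw [← hk]; ring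
    calc i = ((↑u⁻¹ : ZMod m) * ↑u) * i := by rw [Units.inv_mul, one_mul]
      _ = ↑u⁻¹ * (2 * i) := by rw [hu, mul_assoc]
      _ = d * (k * ↑u⁻¹) := by rw [this]; ring

/-- `3^l` is odd. [claim: Mochizuki2012, status: disputed] (IUTchII §2 Def 2.3 (iii), kurims p.68) -/
theorem odd_three_pow (l : ℕ) : Odd (3 ^ l) := Odd.pow (by decide)

/-- **In `D_{3^l}` the subgroups `K_{3^t}` (`t < l`) are told apart by their rotations**: `r^{3^s} ∈ K_{3^t}`
with `s < l`... forces `t ≤ s`. [claim: Mochizuki2012, status: disputed] (IUTchII §2 Def 2.3 (iii), kurims p.68) -/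
theorem le_of_pow_three_mem_dsub {l s t : ℕ} (ht : t ≤ l)
    (h : r ((3 ^ s : ℕ) : ZMod (3 ^ l)) ∈ dsub (3 ^ l) ((3 ^ t : ℕ) : ZMod (3 ^ l))) : t ≤ s := by
  obtain ⟨k, hk⟩ := (r_mem_dsub_iff _ _ _).mp h
  haveI : NeZero (3 ^ t) := ⟨pow_ne_zero t (by norm_num)⟩
  have hdvd : 3 ^ t ∣ 3 ^ l := Nat.pow_dvd_pow 3 ht
  -- reduce modulo `3^t`
  have hcast := congrArg (ZMod.castHom hdvd (ZMod (3 ^ t))) hk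
  rw [map_natCast, map_mul, map_natCast, ZMod.natCast_self, zero_mul, ZMod.natCast_eq_zero_iff] at hcast
  exact (Nat.pow_dvd_pow_iff_le_right (by norm_num)).mp hcast

end DihedralCuspToy

end Literature.IUT.HodgeArakelov
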